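import Summits.NavierStokesRegularity.NavierStokesRegularity.Theorems.PerpetualPumpAveragedTypeIBlowupTrailPair

/-!
# Crux `PerpetualPump.AveragedTypeIBlowup` (stmt-NavierStokesRegularity-1835), line `Sketch`:
# stub `trailPairLoose` — the quiet trail with a loose neighbour box

This file proves the stub `stub_trailPairLoose` registered on the crux item for the joint trail
bootstrap of the line skeleton `Cruxes/AveragedTypeIBlowup/Lines/Sketch.lean`: the statement of
`stub_trailPair` (`PerpetualPumpAveragedTypeIBlowupTrailPair.lean`) with the neighbour hypotheses
weakened to `|wl| ≤ 2ω` (spent bond below) and `br ∈ [-1/2, 9/10]` (residual carrier above) — the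
box in which the neighbours are known a little beyond the certified time. The conclusions are those
of `stub_trailPair` except for the carrier-majorant floor, which is `6ω²/θ` instead of `3ω²/θ`:
with `|wl| ≤ 2ω` the carrier bracket `|-wk² + wl² - ε̄ bk wk|` may be as large as `5.05 ω²`
persistently (take `wl ≡ 2ω`), so the floor `3ω²/θ` is false in the loose box and `(2² + 2)ω²/θ`
is what the Duhamel majorant gives. It is `trailPair_general` with `L = 2`.

## References

* T. Tao, *Finite time blowup for an averaged three-dimensional Navier–Stokes equation*, J. Amer.
  Math. Soc. 29 (2016), 601–674, §5–6 (folklore ODE bootstrap).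
-/

noncomputable section

-- the summit namespace `…NavierStokesRegularity.NavierStokesRegularity…` is the tree convention
set_option linter.dupNamespace false

open MeasureTheory Set Filter Topology

namespace Summit.NavierStokesRegularity.NavierStokesRegularity.Theorems.PerpetualPumpAveragedTypeIBlowup

/-- **Registered stub `stub_trailPairLoose`** (line `Sketch`, crux `PerpetualPump.AveragedTypeIBlowup`,
stmt-NavierStokesRegularity-1835): the quiet trail of a spent carrier/bond pair as in
`stub_trailPair`, but with the LOOSE neighbour box `|wl| ≤ 2ω`, `br ∈ [-1/2, 9/10]`; conclusions
`bk ∈ [-9/20, 7/20]`, `|wk| ≤ ω`, `|bk - bk(0)e^{-τ}| ≤ 1/20`, `m₀ ≤ μe^{-θτ} + 6ω²/θ`,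
`m₁ ≤ μe^{-θτ} + 3ω/θ` on `[0, T]` (`trailPair_general` with `L = 2`). [folklore] -/
theorem stub_trailPairLoose :
    ∀ (bk wk m0 m1 wl br e0 e1 : ℝ → ℝ) (θ η εb ω μ T : ℝ),
      1 / 2 ≤ θ → θ ≤ 1 → 0 ≤ η → 0 < εb → 10 * εb ≤ ω → ω ≤ 1 / 100 → 0 ≤ μ →
      η * μ ≤ θ / 10 → η * μ ≤ ω / 12 → η ≤ θ / 100 → 0 ≤ T →
      ContinuousOn bk (Icc 0 T) → ContinuousOn wk (Icc 0 T) → ContinuousOn m0 (Icc 0 T) →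
      ContinuousOn m1 (Icc 0 T) → ContinuousOn wl (Icc 0 T) → ContinuousOn br (Icc 0 T) →
      ContinuousOn e0 (Icc 0 T) → ContinuousOn e1 (Icc 0 T) →
      (∀ τ ∈ Ioo 0 T, HasDerivAt bk (-(bk τ) - (wk τ) ^ 2 + (wl τ) ^ 2 - εb * bk τ * wk τ + e0 τ) τ) →
      (∀ τ ∈ Ioo 0 T, HasDerivAt wk (wk τ * (bk τ - br τ - 1) + εb * (bk τ) ^ 2 + e1 τ) τ) →
      (∀ τ ∈ Icc 0 T, |e0 τ| ≤ η * m0 τ) → (∀ τ ∈ Icc 0 T, |e1 τ| ≤ η * m1 τ) →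
      (∀ τ ∈ Icc 0 T, 0 ≤ m0 τ ∧ m0 τ ≤ m0 0 * Real.exp (-(θ * τ)) +
        ∫ u in (0 : ℝ)..τ, Real.exp (-(θ * (τ - u))) * |-(wk u) ^ 2 + (wl u) ^ 2 - εb * bk u * wk u|) →
      (∀ τ ∈ Icc 0 T, 0 ≤ m1 τ ∧ m1 τ ≤ m1 0 * Real.exp (-(θ * τ)) +
        ∫ u in (0 : ℝ)..τ, Real.exp (-(θ * (τ - u))) * |wk u * (bk u - br u) + εb * (bk u) ^ 2|) →
      (∀ τ ∈ Icc 0 T, |wl τ| ≤ 2 * ω) → (∀ τ ∈ Icc 0 T, -(1 / 2) ≤ br τ ∧ br τ ≤ 9 / 10) →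
      -(2 / 5) ≤ bk 0 → bk 0 ≤ 3 / 10 → |wk 0| ≤ ω / 2 → m0 0 ≤ μ → m1 0 ≤ μ →
      ∀ τ ∈ Icc 0 T, -(9 / 20) ≤ bk τ ∧ bk τ ≤ 7 / 20 ∧ |wk τ| ≤ ω ∧
        |bk τ - bk 0 * Real.exp (-τ)| ≤ 1 / 20 ∧
        m0 τ ≤ μ * Real.exp (-(θ * τ)) + 6 * ω ^ 2 / θ ∧ m1 τ ≤ μ * Real.exp (-(θ * τ)) + 3 * ω / θ := by
  intro bk wk m0 m1 wl br e0 e1 θ η εb ω μ T hθ hθ1 hη hεb hεω hω1 hμ _ hημω hηθ hT hbk hwk _ _ hwl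
    hbr _ _ hdb hdw he0 he1 hm0 hm1 hwlω hbrI hb0l hb0u hw0 hm00 hm10 τ hτ
  obtain ⟨h1, h2, h3, h4, h5, h6⟩ := trailPair_general (L := 2) zero_le_two le_rfl hθ hθ1
    hη hεb hεω hω1 hμ hημω hηθ hT hbk hwk hwl hbr hdb hdw he0 he1 hm0 hm1 hwlω hbrI hb0l hb0u hw0
    hm00 hm10 τ hτ
  refine ⟨h1, h2, h3, h4, ?_, h6⟩
  have h7 : ((2 : ℝ) ^ 2 + 2) * ω ^ 2 / θ = 6 * ω ^ 2 / θ := by norm_num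
  rw [h7] at h5
  exact h5

end Summit.NavierStokesRegularity.NavierStokesRegularity.Theorems.PerpetualPumpAveragedTypeIBlowup

end
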